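import Summits.ValiantsHypothesis.ValiantsHypothesis.Theorems.GrenetZeonDualUnipotentThreeHalvesHeavyTopWeightShadow

/-!
# `GrenetZeon.DualUnipotentThreeHalves` (stmt-ValiantsHypothesis-24318), R2 `HeavyTopLaw` — PORT of val-idea-27's
# `Cruxes/DualUnipotentThreeHalves/WeightShadow.lean` @9b27f785c669 (cards «graded-shadow» / «pluecker-gap»), part (P2): the Plücker degree — ★ K0 `unstable_of_strictUpper`, ★ K1a `sum_clip_aux` + `plDeg_clipping`, ★ K1b `unstable_of_deepCertificate`

VERBATIM PORT (desk RULING #313 / director R282 (3); writer val-port-4 g2; AUTHOR OF THE MATHEMATICS AND THE LEAN TEXT: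
val-idea-27 — every statement and proof below is idea-27's, byte-identical apart from the namespace
`…Theorems.GrenetZeon.WeightShadow` and added one-line docstrings where the source had none).  This file: K0 (strictly upper triangular spaces are Plücker-unstable), K1a (the clipping inequality), K1b (every DEEP uniform weight certificate destabilises `[W]`).

NOT ported (stay in `Cruxes/`): `stub_threeWeightLaw` (L4 = the law `ThreeWeightLaw`, research rung), the L1 appendix
(`gradedCertificate` over four linear-algebra stubs), the K1c-refuted section.  HONEST LABEL: helper-currency port of an
ideator's SORRY-FREE lemmas; nothing here bears on R2 `HeavyTopLaw`, 24318, S3b or 8062 beyond what the Cruxes file already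
said; `VP ≠ VNP` is NOT proved; no summit statement is proved here.  No named facts.
-/

noncomputable section

-- single-conjunct layout: Sub = Summit, duplicated namespace component intended
set_option linter.dupNamespace false

namespace Summit.ValiantsHypothesis.ValiantsHypothesis.Theorems.GrenetZeon.WeightShadow

open MvPolynomial Matrix
open scoped BigOperators
open Summit.ValiantsHypothesis.ValiantsHypothesis.Cruxes.TwoDimCoefficients.DimTwoCases (AffMat IsAffine)
open Summit.ValiantsHypothesis.ValiantsHypothesis.Theorems.GrenetZeon.RadicalSplit

variable {m : ℕ}

/-- Triangularisable spaces are unstable (`ρ`-cocharacter: every element has lowest weight `≥ 1`, degree `≥ dim W`);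
more generally EVERY uniform flag certificate of the tree (R1 Loewy flag, Theorem G/G′ invariant flag, G″ weight flag
with `c·dim W_{≥c} > r·codim`) forces `PlUnstable`.  Instance typed: the strictly-upper case. -/
theorem unstable_of_strictUpper (W : Submodule ℂ (Matrix (Fin m) (Fin m) ℂ)) (hW : W ≠ ⊥)
    (hup : ∀ X ∈ W, ∀ i j : Fin m, j ≤ i → X i j = 0) : PlUnstable W := by
  classical
  obtain ⟨X, hXW, hX0⟩ := (Submodule.ne_bot_iff W).1 hW
  obtain ⟨i₀, j₀, -⟩ : ∃ i j : Fin m, X i j ≠ 0 := by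
    by_contra h
    push Not at h
    exact hX0 (Matrix.ext h)
  have hm : 1 ≤ m := i₀.pos
  set lvl : Fin m → ℕ := fun i => m - 1 - (i : ℕ) with hlvl_def
  have hle : ∀ d : ℤ, d ≤ 1 → W ≤ wtFilt 1 lvl d := by
    intro d hd Y hY
    apply Submodule.subset_span
    intro i j hw
    have hconj : conj 1 Y = Y := by simp [conj]
    rw [hconj]
    apply hup Y hY
    by_contra hji
    push Not at hji
    have hji' : (i : ℕ) < (j : ℕ) := hji
    have hi := i.isLt
    have hj := j.isLt
    simp only [wt, hlvl_def] at hw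
    omega
  have hinf : ∀ d : ℤ, d ≤ 1 → W ⊓ wtFilt 1 lvl d = W := fun d hd => inf_eq_left.2 (hle d hd)
  have hpos : 0 < (Module.finrank ℂ W : ℤ) := by
    have : 0 < Module.finrank ℂ W :=
      Module.finrank_pos_iff_exists_ne_zero.2 ⟨⟨X, hXW⟩, fun h => hX0 (by simpa using congrArg Subtype.val h)⟩
    exact_mod_cast this
  refine ⟨1, lvl, m, fun i => ?_, ?_⟩
  · have hi := i.isLt
    simp only [hlvl_def]
    omega
  · unfold plDeg
    have h2 : ∑ d ∈ Finset.Icc (1 - (m : ℤ)) 0,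
        ((Module.finrank ℂ W : ℤ) - (Module.finrank ℂ ↥(W ⊓ wtFilt 1 lvl d) : ℤ)) = 0 := by
      apply Finset.sum_eq_zero
      intro d hd
      rw [Finset.mem_Icc] at hd
      rw [hinf d (by linarith [hd.2])]
      exact sub_self _
    have h1 : (Module.finrank ℂ W : ℤ) ≤
        ∑ d ∈ Finset.Icc (1 : ℤ) m, (Module.finrank ℂ ↥(W ⊓ wtFilt 1 lvl d) : ℤ) := by
      have hmem : (1 : ℤ) ∈ Finset.Icc (1 : ℤ) m := by
        rw [Finset.mem_Icc]
        exact ⟨le_rfl, by exact_mod_cast hm⟩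
      have hsum := Finset.single_le_sum
        (f := fun d : ℤ => (Module.finrank ℂ ↥(W ⊓ wtFilt 1 lvl d) : ℤ))
        (fun d _ => by positivity) hmem
      rw [hinf 1 le_rfl] at hsum
      exact hsum
    rw [h2]
    linarith

/-- Arithmetic core of the clipping inequality: an antitone `f : ℤ → ℤ` with `0 ≤ f ≤ D` and `f = D` on `(−∞, −r]`. -/
theorem sum_clip_aux (f : ℤ → ℤ) (D : ℤ) (p r c : ℕ) (hcp : c ≤ p)
    (anti : ∀ d d' : ℤ, d ≤ d' → f d' ≤ f d) (fleD : ∀ d, f d ≤ D) (fnn : ∀ d, 0 ≤ f d)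
    (flow : ∀ d : ℤ, d ≤ -(r : ℤ) → f d = D) :
    ((c : ℤ) + r) * f c - r * D ≤
      (∑ d ∈ Finset.Icc (1 : ℤ) p, f d) - ∑ d ∈ Finset.Icc (1 - (p : ℤ)) 0, (D - f d) := by
  classical
  have h1 : (c : ℤ) * f c ≤ ∑ d ∈ Finset.Icc (1 : ℤ) p, f d := by
    calc (c : ℤ) * f c = ∑ _d ∈ Finset.Icc (1 : ℤ) c, f c := by
            rw [Finset.sum_const, Int.card_Icc, nsmul_eq_mul]
            simp
      _ ≤ ∑ d ∈ Finset.Icc (1 : ℤ) c, f d :=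
            Finset.sum_le_sum fun d hd => anti d c (by rw [Finset.mem_Icc] at hd; exact hd.2)
      _ ≤ ∑ d ∈ Finset.Icc (1 : ℤ) p, f d :=
            Finset.sum_le_sum_of_subset_of_nonneg
              (Finset.Icc_subset_Icc_right (by exact_mod_cast hcp)) (fun d _ _ => fnn d)
  have h2 : ∑ d ∈ Finset.Icc (1 - (p : ℤ)) 0, (D - f d) ≤ r * (D - f c) := by
    calc ∑ d ∈ Finset.Icc (1 - (p : ℤ)) 0, (D - f d)
        ≤ ∑ d ∈ Finset.Icc (1 - (p : ℤ)) 0, (if -(r : ℤ) < d then D - f c else 0) := by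
          apply Finset.sum_le_sum
          intro d hd
          rw [Finset.mem_Icc] at hd
          split_ifs with h
          · linarith [anti d c (by linarith : d ≤ (c : ℤ))]
          · rw [flow d (not_lt.1 h)]
            simp
      _ = ∑ _d ∈ (Finset.Icc (1 - (p : ℤ)) 0).filter (fun d => -(r : ℤ) < d), (D - f c) := by
          rw [Finset.sum_filter]
      _ = (((Finset.Icc (1 - (p : ℤ)) 0).filter (fun d => -(r : ℤ) < d)).card : ℤ) * (D - f c) := by
          rw [Finset.sum_const, nsmul_eq_mul]
      _ ≤ r * (D - f c) := by
          apply mul_le_mul_of_nonneg_right _ (by linarith [fleD c])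
          have hsub : (Finset.Icc (1 - (p : ℤ)) 0).filter (fun d => -(r : ℤ) < d) ⊆
              Finset.Icc (1 - (r : ℤ)) 0 := by
            intro d hd
            rw [Finset.mem_filter, Finset.mem_Icc] at hd
            rw [Finset.mem_Icc]
            constructor <;> linarith [hd.1.1, hd.1.2, hd.2]
          calc (((Finset.Icc (1 - (p : ℤ)) 0).filter (fun d => -(r : ℤ) < d)).card : ℤ)
              ≤ (Finset.Icc (1 - (r : ℤ)) 0).card := by exact_mod_cast Finset.card_le_card hsub
            _ = r := by
              rw [Int.card_Icc]
              simp
  linarith [h1, h2]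

/-- **CLIPPING INEQUALITY (K1a, pure GIT bookkeeping — PROVED v1.4):** if every element of `W` has `λ`-weights `≥ −r`
then `plDeg ≥ (c + r)·dim(W ∩ F_{≥c}) − r·dim W` — the certificate functional `Ψ_{r,c} = Σ_X ψ(lowest wt X)`,
`ψ = c` on `[c,∞)`, `ψ = −r` on `[−r,c)`, satisfies `ψ ≤ id` on `[−r,∞)`, and `plDeg = Σ_X lowest wt X` (Abel summation). -/
theorem plDeg_clipping (W : Submodule ℂ (Matrix (Fin m) (Fin m) ℂ)) (P : (Matrix (Fin m) (Fin m) ℂ)ˣ)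
    (lvl : Fin m → ℕ) (p r c : ℕ) (hcp : c ≤ p) (hlow : W ≤ wtFilt P lvl (-(r : ℤ))) :
    ((c : ℤ) + r) * (Module.finrank ℂ ↥(W ⊓ wtFilt P lvl c) : ℤ) - r * (Module.finrank ℂ W : ℤ) ≤
      plDeg W P lvl p := by
  have filt_anti : ∀ d d' : ℤ, d ≤ d' → wtFilt P lvl d' ≤ wtFilt P lvl d := by
    intro d d' hdd'
    apply Submodule.span_mono
    intro M hM i j hw
    exact hM i j (lt_of_lt_of_le hw hdd')
  have anti : ∀ d d' : ℤ, d ≤ d' →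
      (Module.finrank ℂ ↥(W ⊓ wtFilt P lvl d') : ℤ) ≤ (Module.finrank ℂ ↥(W ⊓ wtFilt P lvl d) : ℤ) := by
    intro d d' hdd'
    exact_mod_cast Submodule.finrank_mono (inf_le_inf_left W (filt_anti d d' hdd'))
  have fleD : ∀ d : ℤ, (Module.finrank ℂ ↥(W ⊓ wtFilt P lvl d) : ℤ) ≤ (Module.finrank ℂ W : ℤ) := by
    intro d
    exact_mod_cast Submodule.finrank_mono (inf_le_left : W ⊓ wtFilt P lvl d ≤ W)
  have fnn : ∀ d : ℤ, (0 : ℤ) ≤ (Module.finrank ℂ ↥(W ⊓ wtFilt P lvl d) : ℤ) := fun d => by positivity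
  have flow : ∀ d : ℤ, d ≤ -(r : ℤ) →
      (Module.finrank ℂ ↥(W ⊓ wtFilt P lvl d) : ℤ) = (Module.finrank ℂ W : ℤ) := by
    intro d hd
    have : W ⊓ wtFilt P lvl d = W := inf_eq_left.2 (le_trans hlow (filt_anti d _ hd))
    rw [this]
  have := sum_clip_aux (fun d => (Module.finrank ℂ ↥(W ⊓ wtFilt P lvl d) : ℤ)) (Module.finrank ℂ W : ℤ)
    p r c hcp anti fleD fnn flow
  simpa [plDeg] using this

/-- **DEEP uniform weight certificates destabilise `[W]` (K1b — PROVED v1.4, the exact constant).**  From a certificate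
`(P, lvl; p, r, c, K)` of a top-heavy affine pencil (`n² ≤ dim W + n`): `W ≤ F_{≥−r}` (by `hdrop`, evaluating the conjugated
polynomial matrix), `dim(W ∩ F_{≥c}) ≥ dim T(K) ≥ dim K − dim ker T ≥ dim K + dim W − 1 − n²` (tops of `K` climb; rank–nullity for the
top map `T` and `W ≤ ℂ·N(0) + range T`), and the clipping inequality K1a gives
`plDeg ≥ (c+r)·dim(W ∩ F_{≥c}) − r·dim W ≥ n(p − r) + c(dim W − n²) ≥ n·(p − r − c) > 0`
as soon as the certificate is DEEP: `p > r + c` (with G″'s budget `((p−1+r(n−1))/(c+r) + 1)·n < dim K`).  Every `r = 0` certificate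
(R1 Loewy flags, Theorem G/G′: `c = 1 < p`) is deep; so is G″ on `L_k`, `B(a,b)`, the MOR-inflations.  SHALLOW drop-certificates
(`p ≤ r + c`, e.g. `p = 2, r = c = 1`) are NOT covered: there the bound is `≥ 0`, not `> 0`; whether they still force instability is
OPEN (K1c below).  CONTRAPOSITIVE (the kill-switch, now a theorem for deep certificates): a Plücker-SEMISTABLE top-heavy pencil space
admits NO deep uniform weight certificate. -/
theorem unstable_of_deepCertificate {n : ℕ} {N : AffMat n m} (hN : IsAffine N)
    {P : (Matrix (Fin m) (Fin m) ℂ)ˣ} {lvl : Fin m → ℕ} {p r c : ℕ} {K : Submodule ℂ (Fin n × Fin n → ℂ)}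
    (h : Certifies N P lvl p r c K) (hdeep : r + c < p) (hn : 1 ≤ n)
    (htop : n ^ 2 ≤ Module.finrank ℂ (pencilSpace N) + n) :
    PlUnstable (pencilSpace N) := by
  classical
  obtain ⟨hc, hlvl, hdrop, hK, hdim⟩ := h
  -- (1) conjugated evaluations vanish where the certificate drops more than `r`
  have hconj_eval : ∀ (x : Fin n × Fin n → ℂ) (i j : Fin m), lvl i + r < lvl j →
      conj P (N.map (MvPolynomial.eval x)) i j = 0 := by
    intro x i j hij
    have key : (((P : Matrix (Fin m) (Fin m) ℂ).map C * N * (↑P⁻¹ : Matrix (Fin m) (Fin m) ℂ).map C :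
        Matrix (Fin m) (Fin m) (MvPolynomial (Fin n × Fin n) ℂ))).map (MvPolynomial.eval x)
        = conj P (N.map (MvPolynomial.eval x)) := by
      simp only [Matrix.map_mul, Matrix.map_map, Function.comp_def, MvPolynomial.eval_C, Matrix.map_id', conj]
    have hentry : conj P (N.map (MvPolynomial.eval x)) i j =
        MvPolynomial.eval x ((((P : Matrix (Fin m) (Fin m) ℂ).map C * N *
          (↑P⁻¹ : Matrix (Fin m) (Fin m) ℂ).map C :
            Matrix (Fin m) (Fin m) (MvPolynomial (Fin n × Fin n) ℂ))) i j) := by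
      rw [← key, Matrix.map_apply]
    rw [hentry, hdrop i j hij, map_zero]
  -- (2) the pencil space lies in the `(≥ −r)`-piece of the filtration
  have hgen : ∀ x : Fin n × Fin n → ℂ, N.map (MvPolynomial.eval x) ∈ wtFilt P lvl (-(r : ℤ)) := by
    intro x
    apply Submodule.subset_span
    intro i j hw
    apply hconj_eval x i j
    simp only [wt] at hw
    omega
  have hlow : pencilSpace N ≤ wtFilt P lvl (-(r : ℤ)) := by
    apply Submodule.span_le.2
    rintro M (hM | ⟨v, rfl⟩)
    · rw [Set.mem_singleton_iff] at hM
      rw [hM]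
      exact hgen 0
    · show N.map _ - N.map _ ∈ _
      exact Submodule.sub_mem _ (hgen v) (hgen 0)
  -- (3) the tops of `K` lie in `W ∩ F_{≥ c}`
  obtain ⟨T, hT⟩ := exists_topMap_linPart N hN
  have hmapK : K.map T ≤ pencilSpace N ⊓ wtFilt P lvl c := by
    intro M hM
    rw [Submodule.mem_map] at hM
    obtain ⟨v, hv, rfl⟩ := hM
    rw [hT]
    refine Submodule.mem_inf.2 ⟨Submodule.subset_span (Or.inr ⟨v, rfl⟩), ?_⟩
    apply Submodule.subset_span
    intro i j hw
    apply hK v hv i j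
    simp only [wt] at hw
    omega
  have hW_le : pencilSpace N ≤ Submodule.span ℂ {N.map (MvPolynomial.eval 0)} ⊔ LinearMap.range T := by
    apply Submodule.span_le.2
    rintro M (hM | ⟨v, rfl⟩)
    · exact Submodule.mem_sup_left (Submodule.subset_span hM)
    · apply Submodule.mem_sup_right
      rw [← hT]
      exact LinearMap.mem_range_self T v
  -- (4) dimension bookkeeping
  have hDle : Module.finrank ℂ (pencilSpace N) ≤ 1 + Module.finrank ℂ (LinearMap.range T) := by
    calc Module.finrank ℂ (pencilSpace N)
        ≤ Module.finrank ℂ ↥(Submodule.span ℂ {N.map (MvPolynomial.eval 0)} ⊔ LinearMap.range T) :=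
          Submodule.finrank_mono hW_le
      _ ≤ Module.finrank ℂ (Submodule.span ℂ {N.map (MvPolynomial.eval 0)}) +
            Module.finrank ℂ (LinearMap.range T) :=
          Submodule.finrank_add_le_finrank_add_finrank _ _
      _ ≤ 1 + Module.finrank ℂ (LinearMap.range T) := by
          gcongr
          exact (finrank_span_le_card _).trans (by simp)
  have hRN : Module.finrank ℂ (LinearMap.range T) + Module.finrank ℂ (LinearMap.ker T) = n * n := by
    rw [LinearMap.finrank_range_add_finrank_ker, Module.finrank_fintype_fun_eq_card, Fintype.card_prod,
      Fintype.card_fin]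
  have hRNK : Module.finrank ℂ ↥(K.map T) + Module.finrank ℂ ↥(LinearMap.ker (T.domRestrict K)) =
      Module.finrank ℂ K := by
    rw [← LinearMap.range_domRestrict]
    exact LinearMap.finrank_range_add_finrank_ker _
  have hkerle : Module.finrank ℂ ↥(LinearMap.ker (T.domRestrict K)) ≤ Module.finrank ℂ (LinearMap.ker T) := by
    rw [LinearMap.ker_domRestrict, ← Submodule.finrank_map_subtype_eq K, Submodule.map_comap_subtype]
    exact Submodule.finrank_mono inf_le_right
  have ha : Module.finrank ℂ ↥(K.map T) ≤ Module.finrank ℂ ↥(pencilSpace N ⊓ wtFilt P lvl c) :=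
    Submodule.finrank_mono hmapK
  -- (5) the floor-division budget of G″
  have hF1 : p + r * n ≤ (c + r) * ((p - 1 + r * (n - 1)) / (c + r)) + (c + r) + r := by
    have hq : 0 < c + r := by omega
    have h1 := Nat.div_add_mod (p - 1 + r * (n - 1)) (c + r)
    have h2 := Nat.mod_lt (p - 1 + r * (n - 1)) hq
    have h3 : r * (n - 1) = r * n - r := Nat.mul_sub_one r n
    have h4 : r ≤ r * n := Nat.le_mul_of_pos_right r hn
    rw [h3] at h1 h2 ⊢
    generalize (p - 1 + (r * n - r)) / (c + r) = k at h1 ⊢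
    generalize (p - 1 + (r * n - r)) % (c + r) = md at h1 h2
    generalize r * n = rn at h1 h2 h4 ⊢
    generalize hq' : c + r = q at h1 h2 hq ⊢
    generalize (q * k) = qk at h1 ⊢
    omega
  -- (6) clipping
  have hclip := plDeg_clipping (pencilSpace N) P lvl p r c (by omega) hlow
  refine ⟨P, lvl, p, hlvl, ?_⟩
  -- cast everything to ℤ
  set k := (p - 1 + r * (n - 1)) / (c + r) with hk
  have e1 : ((k + 1) * n : ℤ) < Module.finrank ℂ K := by exact_mod_cast hdim
  have e2 : (Module.finrank ℂ ↥(K.map T) : ℤ) ≤ Module.finrank ℂ ↥(pencilSpace N ⊓ wtFilt P lvl c) := by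
    exact_mod_cast ha
  have e3 : (Module.finrank ℂ ↥(K.map T) : ℤ) + Module.finrank ℂ ↥(LinearMap.ker (T.domRestrict K)) =
      Module.finrank ℂ K := by exact_mod_cast hRNK
  have e4 : (Module.finrank ℂ ↥(LinearMap.ker (T.domRestrict K)) : ℤ) ≤ Module.finrank ℂ (LinearMap.ker T) := by
    exact_mod_cast hkerle
  have e5 : (Module.finrank ℂ (LinearMap.range T) : ℤ) + Module.finrank ℂ (LinearMap.ker T) = n * n := by
    exact_mod_cast hRN
  have e6 : (Module.finrank ℂ (pencilSpace N) : ℤ) ≤ 1 + Module.finrank ℂ (LinearMap.range T) := by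
    exact_mod_cast hDle
  have e7 : ((n : ℤ)) ^ 2 ≤ Module.finrank ℂ (pencilSpace N) + n := by exact_mod_cast htop
  have e8 : (p : ℤ) + r * n ≤ (c + r) * k + (c + r) + r := by exact_mod_cast hF1
  have e9 : (r : ℤ) + c < p := by exact_mod_cast hdeep
  have e10 : (1 : ℤ) ≤ n := by exact_mod_cast hn
  have hc0 : (0 : ℤ) ≤ c := by positivity
  have hr0 : (0 : ℤ) ≤ r := by positivity
  -- product hints
  have P1 := mul_le_mul_of_nonneg_left e2 (add_nonneg hc0 hr0)
  have P2 := mul_le_mul_of_nonneg_left e1.le (add_nonneg hc0 hr0)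
  have P3 := mul_le_mul_of_nonneg_left e8 (by positivity : (0 : ℤ) ≤ n)
  have P4 := mul_le_mul_of_nonneg_left e7 hc0
  have P5 : (1 : ℤ) * n ≤ (p - r - c) * n := mul_le_mul_of_nonneg_right (by linarith) (by positivity)
  have ea : (Module.finrank ℂ K : ℤ) + Module.finrank ℂ (pencilSpace N) - 1 - n * n ≤
      Module.finrank ℂ ↥(pencilSpace N ⊓ wtFilt P lvl c) := by linarith
  have P6 := mul_le_mul_of_nonneg_left ea (add_nonneg hc0 hr0)
  nlinarith [hclip, P1, P2, P3, P4, P5, P6, e3, e4, e5, e6, e7, e8, e9, e10]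

end Summit.ValiantsHypothesis.ValiantsHypothesis.Theorems.GrenetZeon.WeightShadow

end
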